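import Literature.Geometry.Kaehler.ComplexTorusAnalyticFibreFormula
import Literature.Geometry.Kaehler.ComplexTorusAnalyticClassesCupProductReduction
import Literature.Geometry.Kaehler.ComplexTorusGysinGraphEmbedding
import Literature.Geometry.Kaehler.ComplexTorusDivisorClassesHypersurfaces
import Literature.Geometry.Kaehler.ComplexTorusAnalyticClasses
import Literature.Geometry.Kaehler.ComplexTorusHodgeClassesDimension
import HarnessLib

/-!
# The analytic classes of a complex torus form a ring: `Aᵖ(X) ∧ A^q(X) ⊆ A^{p+q}(X)`, and `D•(X) ⊆ A•(X)`
# on an abelian variety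

Layer `Literature/Geometry/Kaehler`, namespace `Literature.Geometry.Kaehler.ComplexTorus`; lane
`lit-hodgefound`, seat p07, programme «THE ANALYTIC CLASSES OF A COMPLEX TORUS FORM A RING», file 7
(the finale). Closes the gap recorded in `ComplexTorusAnalyticClasses.lean` ("NOT HERE: `Dᵖ(X) ⊆ Aᵖ(X)`
… needs the product formula") and in `ComplexTorusDivisorClassesHypersurfaces.lean`.

* §1 **The restriction to `X₁ × 0` is the pairing with `pr₁^*γ ∧ pr₂^*vol`**
  (`poincarePairing_compContinuousLinearMap_inl_eq`): for every `γ ∈ Alt^k(E₁; ℂ)` and every rational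
  class `β ∈ H^l(X₁ × X₂, ℚ)` of the Euclidean product torus,
  `⟨γ, i₀^*β⟩_{e₁} = sign(e₁) sign(e) ⟨pr₁^*γ ∧ pr₂^*vol_{e₂}, β⟩_e` — the Gysin adjunction
  `⟨f_*α, β⟩ = ⟨α, f^*β⟩` (`poincarePairingRat_gysinMap`) with `(i₀)_*α = ± pr₁^*α ∧ pr₂^*vol`
  (`coe_gysinMap_inlMatrix`) for rational `γ`, extended to complex `γ` by linearity
  (`span_complex_rationalForms_eq_top`), and read on the Euclidean product
  (`poincarePairing_prodPeriodL2_compContinuousLinearMap`).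
* §2 **`[Y₁] ∧ [Y₂] ∈ A^{p₁+p₂}(X)`** for closed analytic `Y₁, Y₂ ⊆ X` of pure codimensions `p₁, p₂`
  (`wedge_analyticCycleClass_mem_analyticClasses`) — Lange 2023 §7.3.1 / Fulton §8.3: by file 1
  (`wedge_analyticCycleClass_eq_compContinuousLinearMap_inl`) `[Y₁] ∧ [Y₂] = i₀^*[W]`,
  `W = σ⁻¹(Y₁ × Y₂) ⊆ X × X`; by §1 its pairing with `γ` is `± ∫_W pr₁^*γ ∧ pr₂^*vol`; by the fibre
  formula of file 6 this is `c ∫_t ⟨γ, cl(W_t)⟩ dt` with `W_t = Y₁ ∩ (Y₂ - t)` (file 1,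
  `shear_preimage_prod_fibre`), a superposition of total classes of subsets of `X`; file 1's criterion
  `wedge_analyticCycleClass_mem_analyticClasses_of_poincarePairing_eq_integral` concludes. (Top and
  over-top codimension are the trivial cases `A^g = H^{2g}(X, ℚ)`, `H^{>2g} = 0`.)
* §3 **`Aᵖ(X) ∧ A^q(X) ⊆ A^{p+q}(X)`** (`wedge_mem_analyticClasses`): bilinearity.
* §4 **`Dᵖ(X) ⊆ Aᵖ(X)` for an abelian variety** (`IsAbelianVariety.divisorClasses_le_analyticClasses`):
  `Dᵖ(X)` is spanned by `[Y₁] ∧ ⋯ ∧ [Y_p]` for hypersurfaces `Yⱼ`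
  (`divisorClasses_eq_span_wedgeFamily_analyticCycleClass`).

Theorems only; no definitions, no named facts.

## References

* [Lange2023AbelianVarietiesComplex] H. Lange, *Abelian Varieties over the Complex Numbers*, Springer
  2023, §7.3.1 (pp. 335–336), §6.2.4 (6.10) p. 310.
* [Fulton1998] W. Fulton, *Intersection Theory*, 2nd ed., Springer 1998, §8.3, §19.2, Example 8.1.11.
* [VoisinHodgeI2002] C. Voisin, *Hodge Theory and Complex Algebraic Geometry I*, CUP 2002, §7.3.2, §11.1.2, §11.3.1.
* [Arapura2012] D. Arapura, *Algebraic Geometry over the Complex Numbers*, Springer 2012, §5.5.2 Lemma 5.5.3.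
-/

noncomputable section

open scoped Manifold Topology ENNReal
open MeasureTheory MeasureTheory.Measure Set Function Filter Module TopologicalSpace WithLp
open Literature.Geometry.GeometricMeasureTheory Literature.LinearAlgebra.Alternating

universe u

namespace Literature.Geometry.Kaehler

namespace ComplexTorus

/-! ### §1 Restriction to `X₁ × 0` versus pairing with `pr₁^*γ ∧ pr₂^*vol` -/

section Restriction

variable {ι₁ ι₂ : Type*} [Fintype ι₁] [Fintype ι₂] [DecidableEq ι₁] [DecidableEq ι₂]
  {E₁ : Type u} [NormedAddCommGroup E₁] [InnerProductSpace ℂ E₁]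
  {E₂ : Type u} [NormedAddCommGroup E₂] [InnerProductSpace ℂ E₂]
  (Φ₁ : (ι₁ → ℝ) ≃L[ℝ] E₁) (Φ₂ : (ι₂ → ℝ) ≃L[ℝ] E₂) {n₁ n N₂ k l : ℕ}
  (e₁ : Fin n₁ ≃ ι₁) (e : Fin n ≃ ι₁ ⊕ ι₂) (e₂ : Fin N₂ ≃ ι₂) (h₁ : k + l = n₁) (h : k + N₂ + l = n)

/-- **`⟨γ, i₀^*β⟩_{X₁} = ± ⟨pr₁^*γ ∧ pr₂^*vol_{X₂}, β⟩_{X₁ × X₂}` for rational `γ` and `β`** (Euclidean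
product torus; `i₀ = ρ(inl) : x ↦ (x, 0)`): the Gysin adjunction `⟨(i₀)_*γ, β⟩ = ⟨γ, i₀^*β⟩` with
`(i₀)_*γ = sign(e₁) sign(e) · pr₁^*γ ∧ pr₂^*vol`. [cite: VoisinHodgeI2002, §7.3.2 (p. 151)]
[cite: Arapura2012, §5.5.2 Lemma 5.5.3] [cite: Lange2023AbelianVarietiesComplex, §6.2.4 (6.10)] -/
theorem poincarePairing_compContinuousLinearMap_inl_eq_of_mem_rationalForms {γ : E₁ [⋀^Fin k]→L[ℝ] ℂ}
    (hγ : γ ∈ rationalForms Φ₁ k) {β : WithLp 2 (E₁ × E₂) [⋀^Fin l]→L[ℝ] ℂ}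
    (hβ : β ∈ rationalForms (prodPeriodL2 Φ₁ Φ₂) l) :
    poincarePairing Φ₁ e₁ h₁ γ
        (β.compContinuousLinearMap (realRep Φ₁ (prodPeriodL2 Φ₁ Φ₂) (inlMatrix ι₁ ι₂))) =
      ((orientationSign Φ₁ e₁ * orientationSign (prodPeriod Φ₁ Φ₂) e : ℤ) : ℂ) *
        poincarePairing (prodPeriodL2 Φ₁ Φ₂) e h
          (((γ.compContinuousLinearMap (ContinuousLinearMap.fst ℝ E₁ E₂)).wedge
              ((volumeForm Φ₂ e₂).compContinuousLinearMap
                (ContinuousLinearMap.snd ℝ E₁ E₂))).compContinuousLinearMap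
            (WithLp.prodContinuousLinearEquiv 2 ℝ E₁ E₂ : WithLp 2 (E₁ × E₂) →L[ℝ] E₁ × E₂)) β := by
  set P := (WithLp.prodContinuousLinearEquiv 2 ℝ E₁ E₂ : WithLp 2 (E₁ × E₂) →L[ℝ] E₁ × E₂) with hP
  -- `β` read on the `sup` product torus
  set β' : (E₁ × E₂) [⋀^Fin l]→L[ℝ] ℂ :=
    β.compContinuousLinearMap (realRep (prodPeriod Φ₁ Φ₂) (prodPeriodL2 Φ₁ Φ₂) 1) with hβ'
  have hβ'mem : β' ∈ rationalForms (prodPeriod Φ₁ Φ₂) l :=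
    comp_realRep_mem_rationalForms (prodPeriod Φ₁ Φ₂) (prodPeriodL2 Φ₁ Φ₂) 1 hβ
  -- the Gysin adjunction for `i₀`, with `(i₀)_* γ = ± pr₁^*γ ∧ pr₂^*vol`
  have hadj := poincarePairingRat_gysinMap Φ₁ (prodPeriod Φ₁ Φ₂) e₁ e h₁ h (inlMatrix ι₁ ι₂) ⟨γ, hγ⟩
    ⟨β', hβ'mem⟩
  have hadjC := congrArg (fun q : ℚ ↦ (q : ℂ)) hadj
  simp only [coe_poincarePairingRat] at hadjC
  rw [coe_gysinMap_inlMatrix Φ₁ Φ₂ e₁ e e₂ h₁ h, coe_pullbackForms_apply, map_smul,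
    LinearMap.smul_apply, smul_eq_mul] at hadjC
  -- `i₀^*β' = i₀^*β` (same map `x ↦ (x, 0)`)
  have h1 : β'.compContinuousLinearMap (realRep Φ₁ (prodPeriod Φ₁ Φ₂) (inlMatrix ι₁ ι₂)) =
      β.compContinuousLinearMap (realRep Φ₁ (prodPeriodL2 Φ₁ Φ₂) (inlMatrix ι₁ ι₂)) := by
    ext v
    simp only [hβ', ContinuousAlternatingMap.compContinuousLinearMap_apply, Function.comp_def,
      realRep_inlMatrix, realRep_one_prodPeriod_prodPeriodL2, realRep_inlMatrix_prodPeriodL2_apply,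
      ContinuousLinearEquiv.coe_coe, ContinuousLinearMap.inl_apply,
      WithLp.prodContinuousLinearEquiv_symm_apply]
  -- `β'` read back on the Euclidean product is `β`
  have h2 : β'.compContinuousLinearMap P = β := by
    ext v
    simp only [hβ', hP, ContinuousAlternatingMap.compContinuousLinearMap_apply, Function.comp_def,
      realRep_one_prodPeriod_prodPeriodL2, ContinuousLinearEquiv.coe_coe,
      ContinuousLinearEquiv.symm_apply_apply]
  rw [h1] at hadjC
  conv_rhs => rw [← h2]
  rw [poincarePairing_prodPeriodL2_compContinuousLinearMap, ← hadjC]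

/-- **`⟨γ, i₀^*β⟩_{X₁} = ± ⟨pr₁^*γ ∧ pr₂^*vol_{X₂}, β⟩_{X₁ × X₂}` for EVERY complex class `γ`** and every
rational `β` (both sides are `ℂ`-linear in `γ`, and the rational classes span `Hᵏ(X₁, ℂ)`).
[cite: VoisinHodgeI2002, §7.3.2 (p. 151)] [cite: Lange2023AbelianVarietiesComplex, §6.2.4 (6.10)] -/
theorem poincarePairing_compContinuousLinearMap_inl_eq (γ : E₁ [⋀^Fin k]→L[ℝ] ℂ)
    {β : WithLp 2 (E₁ × E₂) [⋀^Fin l]→L[ℝ] ℂ} (hβ : β ∈ rationalForms (prodPeriodL2 Φ₁ Φ₂) l) :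
    poincarePairing Φ₁ e₁ h₁ γ
        (β.compContinuousLinearMap (realRep Φ₁ (prodPeriodL2 Φ₁ Φ₂) (inlMatrix ι₁ ι₂))) =
      ((orientationSign Φ₁ e₁ * orientationSign (prodPeriod Φ₁ Φ₂) e : ℤ) : ℂ) *
        poincarePairing (prodPeriodL2 Φ₁ Φ₂) e h
          (((γ.compContinuousLinearMap (ContinuousLinearMap.fst ℝ E₁ E₂)).wedge
              ((volumeForm Φ₂ e₂).compContinuousLinearMap
                (ContinuousLinearMap.snd ℝ E₁ E₂))).compContinuousLinearMap
            (WithLp.prodContinuousLinearEquiv 2 ℝ E₁ E₂ : WithLp 2 (E₁ × E₂) →L[ℝ] E₁ × E₂)) β := by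
  set P := (WithLp.prodContinuousLinearEquiv 2 ℝ E₁ E₂ : WithLp 2 (E₁ × E₂) →L[ℝ] E₁ × E₂) with hP
  -- the cross product with `vol`, a `ℂ`-linear map in `γ`
  set crossL : (E₁ [⋀^Fin k]→L[ℝ] ℂ) →ₗ[ℂ] (WithLp 2 (E₁ × E₂) [⋀^Fin (k + N₂)]→L[ℝ] ℂ) :=
    { toFun := fun γ ↦ ((γ.compContinuousLinearMap (ContinuousLinearMap.fst ℝ E₁ E₂)).wedge
          ((volumeForm Φ₂ e₂).compContinuousLinearMap
            (ContinuousLinearMap.snd ℝ E₁ E₂))).compContinuousLinearMap P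
      map_add' := fun γ γ' ↦ by
        have ha : (γ + γ').compContinuousLinearMap (ContinuousLinearMap.fst ℝ E₁ E₂) =
            γ.compContinuousLinearMap (ContinuousLinearMap.fst ℝ E₁ E₂) +
              γ'.compContinuousLinearMap (ContinuousLinearMap.fst ℝ E₁ E₂) := by
          ext v; rfl
        rw [ha, ContinuousAlternatingMap.wedge_add_left]
        ext v; rfl
      map_smul' := fun c γ ↦ by
        have hs : (c • γ).compContinuousLinearMap (ContinuousLinearMap.fst ℝ E₁ E₂) =
            c • γ.compContinuousLinearMap (ContinuousLinearMap.fst ℝ E₁ E₂) := by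
          ext v; rfl
        rw [hs, wedge_smul_left_complex]
        ext v; rfl } with hcrossL
  set L : (E₁ [⋀^Fin k]→L[ℝ] ℂ) →ₗ[ℂ] ℂ := (poincarePairing Φ₁ e₁ h₁).flip
    (β.compContinuousLinearMap (realRep Φ₁ (prodPeriodL2 Φ₁ Φ₂) (inlMatrix ι₁ ι₂))) with hL
  set R : (E₁ [⋀^Fin k]→L[ℝ] ℂ) →ₗ[ℂ] ℂ :=
    ((orientationSign Φ₁ e₁ * orientationSign (prodPeriod Φ₁ Φ₂) e : ℤ) : ℂ) •
      (((poincarePairing (prodPeriodL2 Φ₁ Φ₂) e h).flip β).comp crossL) with hR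
  have hLR : L = R := by
    refine LinearMap.ext_on (span_complex_rationalForms_eq_top Φ₁ k) fun η hη ↦ ?_
    simp only [hL, hR, LinearMap.flip_apply, LinearMap.smul_apply, LinearMap.comp_apply, smul_eq_mul]
    exact poincarePairing_compContinuousLinearMap_inl_eq_of_mem_rationalForms Φ₁ Φ₂ e₁ e e₂ h₁ h hη hβ
  have hγ := LinearMap.congr_fun hLR γ
  simp only [hL, hR, LinearMap.flip_apply, LinearMap.smul_apply, LinearMap.comp_apply, smul_eq_mul] at hγ
  exact hγ

end Restriction

/-! ### §2 The cup product of two cycle classes is an analytic class -/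

section Product

variable {ι : Type*} [Fintype ι] [DecidableEq ι] {E : Type u} [NormedAddCommGroup E] [InnerProductSpace ℂ E]
  [FiniteDimensional ℂ E] [MeasurableSpace E] [BorelSpace E] (Φ : (ι → ℝ) ≃L[ℝ] E) {n : ℕ} (e : Fin n ≃ ι)

/-- Re-reading the degree of the left argument of the Poincaré pairing. [folklore] -/
private theorem poincarePairing_domDomCongr_left {ι' : Type*} [Fintype ι'] [DecidableEq ι'] {E' : Type*}
    [NormedAddCommGroup E'] [NormedSpace ℂ E'] (Φ' : (ι' → ℝ) ≃L[ℝ] E') {n' k k' l : ℕ}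
    (e' : Fin n' ≃ ι') (hkk : k = k') (h : k + l = n') (h' : k' + l = n') (γ : E' [⋀^Fin k]→L[ℝ] ℂ)
    (δ : E' [⋀^Fin l]→L[ℝ] ℂ) :
    poincarePairing Φ' e' h' (γ.domDomCongr (finCongr hkk)) δ = poincarePairing Φ' e' h γ δ := by
  subst hkk; rfl

/-- Re-reading the DIMENSION of the subset in its cycle class (`d = d'` propositionally): the two
classes agree up to the degree cast. [folklore] -/
private theorem analyticCycleClass_congr_dim {ι' : Type*} [Fintype ι'] [DecidableEq ι'] {E' : Type u}
    [NormedAddCommGroup E'] [InnerProductSpace ℂ E'] [FiniteDimensional ℂ E'] [MeasurableSpace E']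
    [BorelSpace E'] (Φ' : (ι' → ℝ) ≃L[ℝ] E') {n' : ℕ} (e' : Fin n' ≃ ι') {Z : Set (ComplexTorus Φ')}
    {d d' k k' : ℕ} (hd : d = d') (hk : 2 * d + k = n') (hk' : 2 * d' + k' = n')
    (hZ : HasPureDim 𝓘(ℂ, E') Z d) (hZ' : HasPureDim 𝓘(ℂ, E') Z d') :
    analyticCycleClass Φ' e' hk' hZ' =
      (analyticCycleClass Φ' e' hk hZ).domDomCongr (finCongr (by omega : k = k')) := by
  subst hd
  exact analyticCycleClass_eq_domDomCongr Φ' e' hk hk' hZ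

/-- Reindexing commutes with pull-back of forms. [folklore] -/
private theorem domDomCongr_compContinuousLinearMap' {V W : Type*} [NormedAddCommGroup V] [NormedSpace ℝ V]
    [NormedAddCommGroup W] [NormedSpace ℝ W] {m m' : ℕ} (σ : Fin m ≃ Fin m') (ω : W [⋀^Fin m]→L[ℝ] ℂ)
    (L : V →L[ℝ] W) :
    (ω.domDomCongr σ).compContinuousLinearMap L = (ω.compContinuousLinearMap L).domDomCongr σ := by
  ext v; rfl

variable {d₁ d₂ p₁ p₂ : ℕ}

/-- **`[Y₁] ∧ [Y₂] ∈ A^{p₁+p₂}(X)`: the cup product of the fundamental classes of two closed analytic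
subsets of a complex torus is an analytic class** (a `ℚ`-linear combination of fundamental classes of
analytic subsets; classically `[Y₁]·[Y₂] = Σ i(W) [W]` over the components of `Y₁ ∩ (Y₂ - t)` for
generic `t`). Proof: `[Y₁] ∧ [Y₂] = i₀^*[σ⁻¹(Y₁ × Y₂)]` (file 1), whose pairing with `γ ∈ H^{2q}(X, ℂ)`
is `± ∫_{σ⁻¹(Y₁×Y₂)} pr₁^*γ ∧ pr₂^*vol` (§1), `= c ∫_t ⟨γ, cl(Y₁ ∩ (Y₂ - t))⟩ dt` by the fibre formula
(file 6); file 1's annihilator criterion concludes. In top degree `A^g = H^{2g}(X, ℚ)`, above it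
`H^{2p} = 0`. [cite: Lange2023AbelianVarietiesComplex, §7.3.1 (pp. 335–336)] [cite: Fulton1998, §8.3 and §19.2] -/
theorem wedge_analyticCycleClass_mem_analyticClasses (hk₁ : 2 * d₁ + 2 * p₁ = n)
    (hk₂ : 2 * d₂ + 2 * p₂ = n) {Y₁ Y₂ : Set (ComplexTorus Φ)} (hY₁ : HasPureDim 𝓘(ℂ, E) Y₁ d₁)
    (hY₂ : HasPureDim 𝓘(ℂ, E) Y₂ d₂) :
    ((analyticCycleClass Φ e hk₁ hY₁).wedge (analyticCycleClass Φ e hk₂ hY₂)).domDomCongr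
      (finCongr (by ring : 2 * p₁ + 2 * p₂ = 2 * (p₁ + p₂))) ∈ analyticClasses Φ e (p₁ + p₂) := by
  classical
  have hng : finrank ℂ E * 2 = n := finrank_complex_mul_two Φ e
  -- the cup product is a rational class
  have hrat : ((analyticCycleClass Φ e hk₁ hY₁).wedge (analyticCycleClass Φ e hk₂ hY₂)).domDomCongr
      (finCongr (by ring : 2 * p₁ + 2 * p₂ = 2 * (p₁ + p₂))) ∈ rationalForms Φ (2 * (p₁ + p₂)) :=
    (cupProduct Φ (by ring : 2 * p₁ + 2 * p₂ = 2 * (p₁ + p₂))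
      ⟨analyticCycleClass Φ e hk₁ hY₁, analyticCycleClass_mem_rationalForms Φ e hk₁ hY₁⟩
      ⟨analyticCycleClass Φ e hk₂ hY₂, analyticCycleClass_mem_rationalForms Φ e hk₂ hY₂⟩).2
  rcases lt_trichotomy (finrank ℂ E) (p₁ + p₂) with hlt | heq | hgt
  · -- above the top degree: `H^{2p}(X, ℚ) = 0`
    rw [rationalForms_two_mul_eq_bot_of_finrank_lt Φ hlt, Submodule.mem_bot] at hrat
    rw [hrat]
    exact zero_mem _
  · -- top degree: `A^g(X) = H^{2g}(X, ℚ)`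
    rw [analyticClasses_eq_rationalForms_of_finrank_eq Φ e heq]
    exact hrat
  -- the main case `q = dim X - p₁ - p₂ > 0`
  obtain ⟨q, hq0, hqg⟩ : ∃ q, 0 < q ∧ q + (p₁ + p₂) = finrank ℂ E :=
    ⟨finrank ℂ E - (p₁ + p₂), by omega, by omega⟩
  have hq : 2 * q + 2 * (p₁ + p₂) = n := by omega
  have hk : 2 * (d₁ + d₂) + (2 * p₁ + 2 * p₂) = n + n := by omega
  have hdq : d₁ + d₂ = q + finrank ℂ E := by omega
  have hk' : 2 * (q + finrank ℂ E) + 2 * (p₁ + p₂) = n + n := by omega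
  have hkh : 2 * q + 2 * finrank ℂ E + 2 * (p₁ + p₂) = n + n := by omega
  have h2 : 2 * q + 2 * finrank ℂ E = 2 * (q + finrank ℂ E) := by ring
  have hn2 : 2 * finrank ℂ E = n := by omega
  -- the product cycle `W = σ⁻¹(Y₁ × Y₂) ⊆ X × X`
  have hW := (isIsogeny_prodPeriodL2_shear Φ).hasPureDim_preimage (prodPeriodL2 Φ Φ) (prodPeriodL2 Φ Φ)
    (hasPureDim_preimage_prodHomeomorphL2_prod Φ Φ hY₁ hY₂)
  have hW' : HasPureDim 𝓘(ℂ, WithLp 2 (E × E))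
      (mapMatrix (prodPeriodL2 Φ Φ) (prodPeriodL2 Φ Φ) (Matrix.fromBlocks 1 0 1 1) ⁻¹'
        (prodHomeomorphL2 Φ Φ ⁻¹' (Y₁ ×ˢ Y₂))) (q + finrank ℂ E) := hdq ▸ hW
  -- orientation and volume data of the second factor
  set e₂ : Fin (2 * finrank ℂ E) ≃ ι := (finCongr hn2).trans e with he₂
  set ν : E [⋀^Fin (2 * finrank ℂ E)]→L[ℝ] ℂ := volumeForm Φ e₂ with hν
  set eK : OrthonormalBasis (Fin (finrank ℂ E)) ℂ E := stdOrthonormalBasis ℂ E with heK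
  set c : ℂ := ((orientationSign Φ e * orientationSign (prodPeriod Φ Φ) (sumEnum e e) : ℤ) : ℂ) *
    ν (complexFrame ⇑eK) with hc
  refine wedge_analyticCycleClass_mem_analyticClasses_of_poincarePairing_eq_integral Φ e hk₁ hk₂ hq hY₁ hY₂
    ((μHE[2 * finrank ℂ E] : Measure E).restrict (periodBox Φ 0))
    (fun t ↦ Y₁ ∩ (fun x ↦ x + cover Φ t) ⁻¹' Y₂) c fun γ ↦ ?_
  -- `[Y₁] ∧ [Y₂] = i₀^*[W]`, read in degree `2(p₁ + p₂)`
  rw [wedge_analyticCycleClass_eq_compContinuousLinearMap_inl Φ e hk₁ hk₂ hk hY₁ hY₂,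
    ← domDomCongr_compContinuousLinearMap',
    ← analyticCycleClass_congr_dim (prodPeriodL2 Φ Φ) (sumEnum e e) hdq hk hk' hW hW',
    poincarePairing_compContinuousLinearMap_inl_eq Φ Φ e (sumEnum e e) e₂ hq hkh γ
      (analyticCycleClass_mem_rationalForms (prodPeriodL2 Φ Φ) (sumEnum e e) hk' hW')]
  -- the pairing with `[W]` is the period of `W`, computed by the fibre formula
  have hpair : poincarePairing (prodPeriodL2 Φ Φ) (sumEnum e e) hkh
      (((γ.compContinuousLinearMap (ContinuousLinearMap.fst ℝ E E)).wedge
          (ν.compContinuousLinearMap (ContinuousLinearMap.snd ℝ E E))).compContinuousLinearMap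
        (WithLp.prodContinuousLinearEquiv 2 ℝ E E : WithLp 2 (E × E) →L[ℝ] E × E))
      (analyticCycleClass (prodPeriodL2 Φ Φ) (sumEnum e e) hk' hW') =
      analyticCyclePeriod (prodPeriodL2 Φ Φ) hW'
        ((((γ.compContinuousLinearMap (ContinuousLinearMap.fst ℝ E E)).wedge
            (ν.compContinuousLinearMap (ContinuousLinearMap.snd ℝ E E))).domDomCongr
          (finCongr h2)).compContinuousLinearMap
          (WithLp.prodContinuousLinearEquiv 2 ℝ E E : WithLp 2 (E × E) →L[ℝ] E × E)) := by
    rw [← poincarePairing_analyticCycleClass (prodPeriodL2 Φ Φ) (sumEnum e e) hk' hW',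
      domDomCongr_compContinuousLinearMap', poincarePairing_domDomCongr_left]
  rw [hpair, analyticCyclePeriod_cross_eq_integral_fibreSlice Φ Φ hq0 hW' γ ν h2 eK, ← mul_assoc]
  -- the fibre integrands agree: `(W_t pure ? ∫_{W_t} γ : 0) = ⟨γ, cl(Y₁ ∩ (Y₂ - π t))⟩`
  congr 1
  refine integral_congr_ae (ae_of_all _ fun t ↦ ?_)
  have hfib : {x : ComplexTorus Φ | (prodHomeomorphL2 Φ Φ).symm (x, cover Φ t) ∈
      mapMatrix (prodPeriodL2 Φ Φ) (prodPeriodL2 Φ Φ) (Matrix.fromBlocks 1 0 1 1) ⁻¹'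
        (prodHomeomorphL2 Φ Φ ⁻¹' (Y₁ ×ˢ Y₂))} = Y₁ ∩ (fun x ↦ x + cover Φ t) ⁻¹' Y₂ :=
    shear_preimage_prod_fibre Φ Y₁ Y₂ (cover Φ t)
  show (if h : HasPureDim 𝓘(ℂ, E) {x : ComplexTorus Φ | (prodHomeomorphL2 Φ Φ).symm (x, cover Φ t) ∈
      mapMatrix (prodPeriodL2 Φ Φ) (prodPeriodL2 Φ Φ) (Matrix.fromBlocks 1 0 1 1) ⁻¹'
        (prodHomeomorphL2 Φ Φ ⁻¹' (Y₁ ×ˢ Y₂))} q then analyticCyclePeriod Φ h γ else 0) =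
    poincarePairing Φ e hq γ (setCycleClass Φ e hq (Y₁ ∩ (fun x ↦ x + cover Φ t) ⁻¹' Y₂))
  by_cases hZt : HasPureDim 𝓘(ℂ, E) {x : ComplexTorus Φ | (prodHomeomorphL2 Φ Φ).symm (x, cover Φ t) ∈
      mapMatrix (prodPeriodL2 Φ Φ) (prodPeriodL2 Φ Φ) (Matrix.fromBlocks 1 0 1 1) ⁻¹'
        (prodHomeomorphL2 Φ Φ ⁻¹' (Y₁ ×ˢ Y₂))} q
  · rw [dif_pos hZt]
    have hZt' : HasPureDim 𝓘(ℂ, E) (Y₁ ∩ (fun x ↦ x + cover Φ t) ⁻¹' Y₂) q := hfib ▸ hZt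
    rw [setCycleClass_of_hasPureDim Φ e hq hZt', poincarePairing_analyticCycleClass]
    -- same set, same period
    have : ∀ {S S' : Set (ComplexTorus Φ)} (hS : HasPureDim 𝓘(ℂ, E) S q) (hS' : HasPureDim 𝓘(ℂ, E) S' q),
        S = S' → analyticCyclePeriod Φ hS γ = analyticCyclePeriod Φ hS' γ := by
      intro S S' hS hS' hSS'
      subst hSS'
      rfl
    exact this hZt hZt' hfib
  · rw [dif_neg hZt, setCycleClass, dif_neg (fun h ↦ hZt (hfib.symm ▸ h)), map_zero]

end Product

/-! ### §3 `A•(X)` is a ring -/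

section Ring

variable {ι : Type*} [Fintype ι] [DecidableEq ι] {E : Type u} [NormedAddCommGroup E] [InnerProductSpace ℂ E]
  [FiniteDimensional ℂ E] [MeasurableSpace E] [BorelSpace E] (Φ : (ι → ℝ) ≃L[ℝ] E) {n : ℕ} (e : Fin n ≃ ι)

omit [FiniteDimensional ℂ E] [MeasurableSpace E] [BorelSpace E] in
/-- Rational scalars act on complex forms through `ℚ ⊆ ℂ`. [folklore] -/
private theorem ratCast_smul_form {m : ℕ} (c : ℚ) (α : E [⋀^Fin m]→L[ℝ] ℂ) : c • α = (c : ℂ) • α := by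
  ext v
  simp [Rat.smul_def]

/-- **The analytic classes form a ring: `Aᵖ(X) ∧ A^q(X) ⊆ A^{p+q}(X)`** (Lange 2023, §7.3.1: the
algebraic classes `cl(Ch•(X)_ℚ)` form a `ℚ`-subalgebra of `H^{2•}(X, ℚ)`; here, at torus level, from
`wedge_analyticCycleClass_mem_analyticClasses` by bilinearity of `∧`).
[cite: Lange2023AbelianVarietiesComplex, §7.3.1 (pp. 335–336)] [cite: Fulton1998, §8.3] -/
theorem wedge_mem_analyticClasses {p q : ℕ} {α : E [⋀^Fin (2 * p)]→L[ℝ] ℂ} {β : E [⋀^Fin (2 * q)]→L[ℝ] ℂ}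
    (hα : α ∈ analyticClasses Φ e p) (hβ : β ∈ analyticClasses Φ e q) :
    (α.wedge β).domDomCongr (finCongr (by ring : 2 * p + 2 * q = 2 * (p + q))) ∈
      analyticClasses Φ e (p + q) := by
  change α ∈ Submodule.span ℚ (analyticCycleClassSet Φ e p) at hα
  change β ∈ Submodule.span ℚ (analyticCycleClassSet Φ e q) at hβ
  induction hα using Submodule.span_induction with
  | mem α hαs =>
    obtain ⟨d₁, hk₁, Y₁, hY₁, rfl⟩ := hαs
    induction hβ using Submodule.span_induction with
    | mem β hβs =>
      obtain ⟨d₂, hk₂, Y₂, hY₂, rfl⟩ := hβs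
      exact wedge_analyticCycleClass_mem_analyticClasses Φ e hk₁ hk₂ hY₁ hY₂
    | zero =>
      rw [ContinuousAlternatingMap.wedge_zero]
      exact zero_mem _
    | add β β' _ _ hβi hβ'i =>
      rw [ContinuousAlternatingMap.wedge_add_right]
      exact add_mem hβi hβ'i
    | smul c β _ hβi =>
      rw [ratCast_smul_form, wedge_smul_right_complex, domDomCongr_finCongr_smul, ← ratCast_smul_form]
      exact Submodule.smul_mem _ c hβi
  | zero =>
    rw [ContinuousAlternatingMap.zero_wedge]
    exact zero_mem _
  | add α α' _ _ hαi hα'i =>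
    rw [ContinuousAlternatingMap.wedge_add_left]
    exact add_mem hαi hα'i
  | smul c α _ hαi =>
    rw [ratCast_smul_form, wedge_smul_left_complex, domDomCongr_finCongr_smul, ← ratCast_smul_form]
    exact Submodule.smul_mem _ c hαi

/-! ### §4 `D•(X) ⊆ A•(X)` on an abelian variety -/

/-- **On an abelian variety every divisor class is an analytic class: `Dᵖ(X) ⊆ Aᵖ(X)`** for all `p`
("the cycle classes in `D•` are all algebraic", Lange 2023, p. 336): `Dᵖ(X)` is spanned by the products
`[Y₁] ∧ ⋯ ∧ [Y_p]` of classes of hypersurfaces (`divisorClasses_eq_span_wedgeFamily_analyticCycleClass`,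
the Lefschetz theorem on `(1,1)`-classes), and `A•(X)` is a ring (§3).
[cite: Lange2023AbelianVarietiesComplex, §7.3.1 (p. 336)] [cite: VoisinHodgeI2002, §11.3.1 Thms. 11.30–11.32] -/
theorem IsAbelianVariety.divisorClasses_le_analyticClasses (hX : IsAbelianVariety Φ) (p : ℕ) :
    divisorClasses Φ p ≤ analyticClasses Φ e p := by
  classical
  by_cases hg : finrank ℂ E < 1
  · -- a point: `Dᵖ = 0` for `p ≥ 1`, `D⁰ = ℚ · 1 = A⁰`
    rcases Nat.eq_zero_or_pos p with rfl | hp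
    · rw [divisorClasses_zero_eq_hodgeClasses, ← analyticClasses_zero_eq_hodgeClasses Φ e]
    · rw [divisorClasses_eq_bot_of_finrank_lt Φ (by omega)]
      exact bot_le
  obtain ⟨e₁, he₁⟩ := exists_orientationSign_eq_one Φ e
  have h : 2 * (finrank ℂ E - 1) + 2 * 1 = n := by
    have h2 := finrank_complex_mul_two Φ e
    omega
  rw [analyticClasses_eq_analyticClasses Φ e₁ e,
    divisorClasses_eq_span_wedgeFamily_analyticCycleClass Φ e₁ h hX he₁ p, Submodule.span_le]
  rintro _ ⟨Y, rfl⟩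
  -- `[Y₁] ∧ ⋯ ∧ [Y_p] ∈ Aᵖ(X)` by induction on `p`
  suffices hind : ∀ m (Y : Fin m → {Z : Set (ComplexTorus Φ) // HasPureDim 𝓘(ℂ, E) Z (finrank ℂ E - 1)}),
      wedgeFamily m (fun j ↦ analyticCycleClass Φ e₁ h (Y j).2) ∈ analyticClasses Φ e₁ m from hind p Y
  intro m
  induction m with
  | zero =>
    intro Y
    rw [wedgeFamily_zero]
    exact oneForm₀_mem_analyticClasses Φ e₁
  | succ m ih =>
    intro Y
    have hmem := wedge_mem_analyticClasses Φ e₁ (ih (Fin.init Y))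
      (analyticCycleClass_mem_analyticClasses Φ e₁ h (Y (Fin.last m)).2)
    have heq : ((wedgeFamily m (Fin.init fun j ↦ analyticCycleClass Φ e₁ h (Y j).2)).wedge
        (analyticCycleClass Φ e₁ h (Y (Fin.last m)).2)).domDomCongr
        (finCongr (by ring : 2 * m + 2 * 1 = 2 * (m + 1))) =
        wedgeFamily (m + 1) (fun j ↦ analyticCycleClass Φ e₁ h (Y j).2) := by
      ext v
      rfl
    rw [← heq]
    exact hmem

/-- **The Hodge `(p,p)`-conjecture in cycle form for an abelian variety whose Hodge classes are divisor
classes**: if `Dᵖ(X) = H^{2p}_Hodge(X)` then `Aᵖ(X) = H^{2p}_Hodge(X)` (`Aᵖ ⊆ H^{2p}_Hodge` always,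
`Dᵖ ⊆ Aᵖ` by the previous theorem) — e.g. for abelian varieties all of whose powers have only divisor
Hodge classes. [cite: Lange2023AbelianVarietiesComplex, §7.3.1 (p. 336)] -/
theorem IsAbelianVariety.analyticClasses_eq_hodgeClasses_of_divisorClasses_eq (hX : IsAbelianVariety Φ)
    {p : ℕ} (hD : divisorClasses Φ p = hodgeClasses Φ p) :
    analyticClasses Φ e p = hodgeClasses Φ p :=
  le_antisymm (analyticClasses_le_hodgeClasses Φ e p)
    (hD ▸ hX.divisorClasses_le_analyticClasses Φ e p)

end Ring

end ComplexTorus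

end Literature.Geometry.Kaehler

end
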